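import Summits.BirchSwinnertonDyer.Rank1Residual.Additive.QuadraticBranchEvenControlLowerNoKO
import Summits.BirchSwinnertonDyer.Rank1Residual.Additive.StrictSignedDualFiniteTorsion
import Summits.BirchSwinnertonDyer.Rank1Residual.Additive.QuadraticBranchOddStrictExactControlDischarge
import HarnessLib

/-!
# Route `QuadraticBranchSignedControl` (rung K8, cell `bsd-potss`), residual crux
# `PlusEtaMainConjectureNonsurj` (stmt-BirchSwinnertonDyer-19606): the BOTTOM LAYER of
# `X⁺_W(ℚ_∞) = X⁺(V/K_∞)^η` on the rows where it kills everything — `A₀⁺` finite from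
# `Sel_{p^∞}(W/ℚ)` finite (so Kobayashi's Thm. 2.2 at `η`, torsion half, is a THEOREM in analytic
# rank `0`), and `(Sel⁺_∞)^γ = 0 ⟹ Sel⁺(W/ℚ_∞) = 0 ⟹ X⁺ = 0` (seat `bsd-potss-k8eta-c2` g2; file 1 of 2)

WHAT. `W/ℚ` is the additive (`I₀*`) partner of a good supersingular `a_p = 0` curve `V`
(`C • W^{(p*)} = V`, `p` odd), `κ` the cyclotomic `ℤ_p`-extension, `γ` a topological generator,
`D : StrictSignedSelmerDualData W κ ℚ_[p] γ 1` a Pontryagin-dual datum of Kobayashi's PLUS Selmer group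
`Sel⁺(W/ℚ_∞)` in `W`-coordinates — by the cell's (D5⁺)/(D5⁺)⁻¹ (`…PlusEtaReverseTransport`, ctrl g4)
the SAME module as `X⁺(V/K_∞)^η`, the object of crux 19606. `A₀⁺ = Sel^{loc,∞,+}(W/ℚ)` is the group of
classes over `ℚ` whose restriction to `ℚ_∞` is plus-Selmer (x1b's B2 group), `S₀⁺ = Sel⁺(W/ℚ_0)`
(`= Sel_{p^∞}(W/ℚ)` in cardinality, ctrl g2 file 1).

* §1 (duality algebra, any dual pair) `eq_zero_of_isLocNil_of_ker_trivial`: `ψ` locally nilpotent on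
  `S` and `ker ψ = 0` ⟹ `S = 0` (no Nakayama, no finite generation); for a strict signed datum:
  `(Sel^{ε,str}_∞)^γ = 0 ⟹ Sel^{ε,str}_∞ = 0` and `X = 0` (`subsingleton_X_of_invariants_trivial`),
  hence `Char(X) = Λ`, `X` torsion, finitely generated.
* §2 (the `p*`-twist, sign `+`, cyclotomic `κ`) `natCard_quotient_dvd_prod_pow`:
  **`#(A₀⁺ ⧸ S₀⁺) ∣ ∏_{v ∈ S, v ∤ p} p^{ord_p c_v(W)}`** WITHOUT assuming `A₀⁺` finite — the tree's
  `natCard_quotient_dvd_prod_natCard_localTowerKerPrimary_of_loc` (ctrl g2) verbatim with its idle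
  `[Finite A₀]` instance dropped and `hloc` discharged by (L0⁺) = Kobayashi's (9.33)
  (`evenBranchPlusLocalControlZeroAt_holds`); so **`Sel_{p^∞}(W/ℚ)` finite ⟹ `A₀⁺` finite**
  (`finite_localPreimage_of_finite_selmer`) and, by x1b's file 110, **every plus dual datum of `W` is
  finitely generated `Λ`-TORSION with `g(0) ≠ 0` for every characteristic generator `g`**
  (`isTorsion_and_constantCoeff_ne_zero_of_finite_selmer`): the torsion half of Kobayashi's Thm. 2.2 at
  `η` is a theorem on every analytic-rank-`0` row (`Ш(W)[p^∞]` finite), Poitou–Tate-free.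
* sequel (`…PlusEtaBottomLayerTrivial.lean`): the UNIT rows — `p ∤ Tam(W)` ⟹ `A₀⁺ = S₀⁺`; with
  `Sel_{p^∞}(W/ℚ) = 0`: `A₀⁺ = 0`, `(Sel⁺_∞)^γ = 0`, `Sel⁺(W/ℚ_∞) = 0`, `X⁺ = 0` for EVERY plus dual
  datum (Greenberg's Prop. 3.8 for Kobayashi's plus structure of the additive twist) — by §1b here.

HONEST FRAMING (cell `bsd-potss`, run/shared/lean/pub/bsd-potss/; FULL-BSD rank ≤ 1 programme,
tranche 1b, HUMAN RULING D-0036/D-0074): TOOL THEOREMS ONLY — no definition, no named Literature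
fact, no Summits-side `def … : Prop`, no `sorry`, axioms standard; UNCONDITIONAL (no named fact in
hypothesis position). Nothing about (C1⁺_η) / Kobayashi's main conjecture / `BSD(W,p)` of any pair is
claimed here (the `η`-side consequences for crux 19606 are the companion file
`…PlusEtaNonsurjMuSaturation.lean`); nothing is booked; no label / mark / count moves.
`--supports stmt-BirchSwinnertonDyer-19606`.

References: [GreenbergLNM1716] §1 (p. 60), §3 Lemma 3.1–3.3 (pp. 85–90), Prop. 3.8 (pp. 95–96), §4
Thm. 4.1 and Lemma 4.2 (p. 102); [Kobayashi2003] Def. 2.1 (p. 5), Thm. 2.2 (p. 5), Prop. 8.7 (p. 16),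
Lemma 9.1 (p. 25), Thm. 9.3 with (9.33) (pp. 26–27).
-/

set_option autoImplicit false
set_option linter.dupNamespace false

noncomputable section

open scoped Classical

open Field Function NumberField IsDedekindDomain WeierstrassCurve
open Literature.NumberTheory.EllipticCurves
open Literature.NumberTheory.GaloisRepresentations
open Literature.NumberTheory.EllipticCurves.IwasawaAlgebra
open Literature.NumberTheory.EllipticCurves.IwasawaDual ZpExtension
open Summit.BirchSwinnertonDyer.Rank1Residual.Additive

universe u

namespace Summit.BirchSwinnertonDyer.BirchSwinnertonDyer.Theorems

namespace EtaBottomLayer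

/-! ## §1 Duality algebra: locally nilpotent with trivial kernel is zero -/

section Algebra

variable {p : ℕ} {S : Type*} [AddCommGroup S] {ψ : AddMonoid.End S}

/-- **`ψ` locally nilpotent on `S` and `ker ψ = 0` ⟹ `S = 0`.** If every `s` is killed by some power
of `ψ` (`IsLocNil`) and `ψ s = 0 ⟹ s = 0`, then `S = 0`: for `ψ^{n+1} s = 0` the element `ψ s` is
killed by `ψ^n`, so by induction `ψ s = 0`, so `s = 0`. The Pontryagin dual of Greenberg's
"`X/TX = 0 ⟹ X = 0`" (LNM 1716 p. 94 fact (1), p. 96), needing neither Nakayama nor finite generation.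
[cite: GreenbergLNM1716, §3 p. 94 fact (1) and p. 96 (proof of Prop. 3.8)] -/
theorem eq_zero_of_isLocNil_of_ker_trivial (hl : IsLocNil p ψ) (hker : ∀ s : S, ψ s = 0 → s = 0)
    (s : S) : s = 0 := by
  obtain ⟨N, hN⟩ := hl.nil s
  induction N generalizing s with
  | zero => simpa using hN
  | succ n ih =>
    rw [pow_succ, AddMonoid.End.coe_mul, Function.comp_apply] at hN
    exact hker s (ih (ψ s) hN)

end Algebra

/-! ## §1b A strict signed dual datum with trivial invariants is the zero module -/

section Dual

variable {K : Type u} [Field K] [NumberField K] (W : WeierstrassCurve K) {p : ℕ} [Fact p.Prime]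
  (κ : ZpExtension K p) (E : Type u) [Field E] [Algebra K E] (ε : ℤˣ)

/-- **`(Sel^{ε,str}(E/K_∞))^γ = 0 ⟹ Sel^{ε,str}(E/K_∞) = 0`** (every class, for `γ` a topological
generator): `conj_γ − 1` is locally nilpotent on `Sel^{ε,str}_∞` (`isLocNil_conjStrictSignedSelmerInfty_sub_one`)
and §1 applies. [cite: GreenbergLNM1716, §3 Prop. 3.8 (proof, p. 96)] [cite: Kobayashi2003, Def. 2.1 (p. 5)] -/
theorem strictSignedSelmerInfty_trivial_of_invariants_trivial {γ : Field.absoluteGaloisGroup K}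
    (hγ : κ.IsTopGenerator γ)
    (h0 : ∀ s : strictSignedSelmerInfty W κ E ε,
      W.conjH1 p κ.kerSubgroup γ (s : W.subgroupH1 p κ.kerSubgroup) = s → s = 0)
    (s : strictSignedSelmerInfty W κ E ε) : s = 0 := by
  refine eq_zero_of_isLocNil_of_ker_trivial (isLocNil_conjStrictSignedSelmerInfty_sub_one W κ E ε hγ)
    (fun t ht ↦ h0 t ?_) s
  have h := coe_conjStrictSignedSelmerInfty_sub_one_apply W κ E ε γ t
  rw [ht, ZeroMemClass.coe_zero, eq_comm, sub_eq_zero] at h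
  exact h

/-- **`(Sel^{ε,str}(E/K_∞))^γ = 0 ⟹ X^{ε,str}(E/K_∞) = 0`** for EVERY Pontryagin-dual datum `D`
(`toDual : X ≅ Hom(Sel^{ε,str}_∞, ℚ/ℤ)` is injective and its target is `Hom(0, ℚ/ℤ) = 0`).
[cite: GreenbergLNM1716, §3 Prop. 3.8 (proof, p. 96)] [cite: Kobayashi2003, Def. 2.1 (p. 5)] -/
theorem subsingleton_X_of_invariants_trivial {γ : Field.absoluteGaloisGroup K}
    (hγ : κ.IsTopGenerator γ) (D : StrictSignedSelmerDualData W κ E γ ε)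
    (h0 : ∀ s : strictSignedSelmerInfty W κ E ε,
      W.conjH1 p κ.kerSubgroup γ (s : W.subgroupH1 p κ.kerSubgroup) = s → s = 0) :
    Subsingleton D.X := by
  have hS := strictSignedSelmerInfty_trivial_of_invariants_trivial W κ E ε hγ h0
  refine subsingleton_of_forall_eq 0 fun x ↦ D.bijective.1 ?_
  ext s
  rw [hS s, map_zero, map_zero]

variable {W κ E ε}

/-- The zero `Λ`-module is torsion. [folklore] -/
theorem isTorsion_of_subsingleton {γ : Field.absoluteGaloisGroup K} (D : StrictSignedSelmerDualData W κ E γ ε)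
    [Subsingleton D.X] : Module.IsTorsion (IwasawaAlgebra p) D.X :=
  fun _ ↦ ⟨1, Subsingleton.elim _ _⟩

/-- The zero `Λ`-module is finitely generated. [folklore] -/
theorem moduleFinite_of_subsingleton {γ : Field.absoluteGaloisGroup K}
    (D : StrictSignedSelmerDualData W κ E γ ε) [Subsingleton D.X] :
    Module.Finite (IwasawaAlgebra p) D.X :=
  haveI : Finite D.X := Finite.of_subsingleton
  Module.Finite.of_finite

/-- The characteristic ideal of the zero `Λ`-module is `Λ` (every local length vanishes) — so for
`X⁺ = 0` Kobayashi's `Char(X⁺(V/K_∞)^η) = (L_p⁺(V,η,X))` says exactly `L_p⁺(V,η,X) ∈ Λˣ`.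
[cite: Washington1997, §13.2] -/
theorem charIdeal_eq_top_of_subsingleton {γ : Field.absoluteGaloisGroup K}
    (D : StrictSignedSelmerDualData W κ E γ ε) [Subsingleton D.X] : D.charIdeal = ⊤ := by
  rw [D.charIdeal_def]
  unfold Module.charIdeal
  rw [← Ideal.one_eq_top]
  exact finprod_mem_of_eqOn_one fun 𝔭 _ ↦ by
    rw [Module.lengthAt_eq_zero_of_subsingleton, ENat.toNat_zero, pow_zero]
    rfl

/-- The zero `Λ`-module has no non-trivial (finite) submodule. [folklore] -/
theorem submodule_eq_bot_of_subsingleton {γ : Field.absoluteGaloisGroup K}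
    (D : StrictSignedSelmerDualData W κ E γ ε) [Subsingleton D.X]
    (N : Submodule (IwasawaAlgebra p) D.X) : N = ⊥ :=
  Subsingleton.elim _ _

end Dual

/-! ## §2 The `p*`-twist, sign `+`: `#(A₀⁺ ⧸ S₀⁺) ∣ ∏ p^{ord_p c_v}` instance-free; `A₀⁺` finite from `Sel` finite -/

section Twist

variable {p : ℕ} [hp : Fact p.Prime] (κ : ZpExtension ℚ p) (W : WeierstrassCurve ℚ) [W.IsElliptic]
  [W.IsGloballyMinimal]

/-- **`#(Sel^{loc,∞,+}(W/ℚ) ⧸ Sel⁺(W/ℚ_0)) ∣ ∏_{v ∈ S, p ∉ v} p^{ord_p c_v(W)}` with NO finiteness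
hypothesis on `A₀⁺`**, for the `p*`-twist `W` of a globally minimal good `a_p = 0` curve `V`, `p` odd,
`κ` cyclotomic, `S` any finite set off which `W` is good and `v ∤ p`. The localisation
`Φ : A₀⁺ → ∏_{v ∈ S, v ∤ p} 𝒦_{v,0}[p^∞]` has `ker Φ ≤ S₀⁺` (x1b's B2 criterion
`mem_strictSignedSelmerLayer_zero_iff_of_layerToInfty_mem`; at `v = (p)` and for the Kummer condition
at `ℚ_[p]` by (L0⁺) = Kobayashi's (9.33), the THEOREM `evenBranchPlusLocalControlZeroAt_holds`), so
`#(A₀⁺⧸S₀⁺) ∣ #range Φ ∣ ∏ #𝒦_{v,0}[p^∞] = ∏ p^{ord_p c_v}` (Greenberg's Lemma 3.3,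
`prod_natCard_localTowerKerPrimary_eq_prod_pow`). Word for word the tree's
`StrictSignedControlZero.natCard_quotient_dvd_prod_natCard_localTowerKerPrimary_of_loc` (ctrl g2),
whose `[Finite A₀]` instance is idle in its proof and is dropped here — so that the divisibility can be
used to PROVE finiteness. [cite: GreenbergLNM1716, §3 Lemma 3.3 (pp. 86–88) and p. 90]
[cite: Kobayashi2003, Thm. 9.3 with (9.33) (pp. 26–27)] -/
theorem natCard_quotient_dvd_prod_pow (hp2 : p ≠ 2) (hκ : κ.IsCyclotomic) (C : VariableChange ℚ)
    (V : WeierstrassCurve ℚ) [V.IsElliptic] [V.IsGloballyMinimal]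
    (hCV : C • W.quadraticTwist ((-1) ^ (p / 2) * p) = V)
    (hgood : V.HasGoodReductionAtPrime p) (hap : V.frobeniusTrace p = 0)
    (S : Finset (HeightOneSpectrum (𝓞 ℚ)))
    (hS : ∀ v ∉ S, (p : 𝓞 ℚ) ∉ v.asIdeal ∧ W.HasGoodReductionAt v) :
    Nat.card (↥((W.selmerInfty κ ⊓
          ⨅ σ : Field.absoluteGaloisGroup ℚ,
            (Kobayashi2003.localKummerOverOfEmb W p κ.kerSubgroup (closureEmb (K := ℚ) ℚ_[p])
                (⨆ m, strictSignedLocalPoints κ ℚ_[p] W 1 m)).comap (W.conjH1 p κ.kerSubgroup σ)).comap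
          (W.layerToInfty κ 0)) ⧸
        (strictSignedSelmerLayer W κ ℚ_[p] 1 0).addSubgroupOf ((W.selmerInfty κ ⊓
          ⨅ σ : Field.absoluteGaloisGroup ℚ,
            (Kobayashi2003.localKummerOverOfEmb W p κ.kerSubgroup (closureEmb (K := ℚ) ℚ_[p])
                (⨆ m, strictSignedLocalPoints κ ℚ_[p] W 1 m)).comap (W.conjH1 p κ.kerSubgroup σ)).comap
          (W.layerToInfty κ 0))) ∣
      ∏ v ∈ S.filter (fun v ↦ (p : 𝓞 ℚ) ∉ v.asIdeal),
        p ^ padicValNat p ((W.baseChange (v.adicCompletion ℚ)).localTamagawaNumber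
          (v.adicCompletionIntegers ℚ)) := by
  -- adapted from `StrictSignedControlZero.natCard_quotient_dvd_prod_natCard_localTowerKerPrimary_of_loc`
  -- (Summits/BirchSwinnertonDyer/Rank1Residual/Additive/QuadraticBranchEvenControlDefect.lean), instance-free
  have hloc := evenBranchPlusLocalControlZeroAt_holds W p V C hp2 hCV hgood hap κ hκ
  set A := (W.selmerInfty κ ⊓
      ⨅ σ : Field.absoluteGaloisGroup ℚ,
        (Kobayashi2003.localKummerOverOfEmb W p κ.kerSubgroup (closureEmb (K := ℚ) ℚ_[p])
            (⨆ m, strictSignedLocalPoints κ ℚ_[p] W 1 m)).comap (W.conjH1 p κ.kerSubgroup σ)).comap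
      (W.layerToInfty κ 0) with hA
  set S0 := strictSignedSelmerLayer W κ ℚ_[p] 1 0 with hS0
  set S' := S.filter (fun v ↦ (p : 𝓞 ℚ) ∉ v.asIdeal) with hS'
  set v₀ : HeightOneSpectrum (𝓞 ℚ) :=
    (Rat.HeightOneSpectrum.primesEquiv (R := 𝓞 ℚ)).symm ⟨p, hp.out⟩ with hv₀
  rw [← StrictSignedControlZero.prod_natCard_localTowerKerPrimary_eq_prod_pow W hκ S]
  -- every `y ∈ A` restricts into `Sel_{p^∞}(W/ℚ_∞)`
  have hsel : ∀ y : A, W.layerToInfty κ 0 (y : W.subgroupH1 p (κ.layerSubgroup 0)) ∈ W.selmerInfty κ :=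
    fun y ↦ (AddSubgroup.mem_inf.mp (AddSubgroup.mem_comap.mp y.2)).1
  -- the receptacle membership: `loc_v y ∈ 𝒦_{v,0}[p^∞]`
  have hmem : ∀ (y : A) (v : HeightOneSpectrum (𝓞 ℚ)),
      W.localResOver p (κ.layerSubgroup 0) (v.adicCompletion ℚ) (y : W.subgroupH1 p (κ.layerSubgroup 0)) ∈
        W.localTowerKerPrimary κ (v.adicCompletion ℚ) 0 := fun y v ↦ by
    refine (W.mem_localTowerKerPrimary_iff κ _ 0 _).mpr
      ⟨localResOver_mem_localTowerKer_zero W κ (hsel y) v, ?_⟩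
    obtain ⟨k, hk⟩ := W.exists_pow_smul_subgroupH1_layer_eq_zero κ 0
      (y : W.subgroupH1 p (κ.layerSubgroup 0))
    exact ⟨k, by rw [← map_nsmul, hk, map_zero]⟩
  -- the localisation away from `p`
  let Φ : A →+ ((v : S') → W.localTowerKerPrimary κ ((v : HeightOneSpectrum (𝓞 ℚ)).adicCompletion ℚ) 0) :=
    { toFun := fun y v ↦ ⟨W.localResOver p (κ.layerSubgroup 0) ((v : HeightOneSpectrum (𝓞 ℚ)).adicCompletion ℚ)
          (y : W.subgroupH1 p (κ.layerSubgroup 0)), hmem y v⟩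
      map_zero' := by
        funext v
        exact Subtype.ext (by simp)
      map_add' := fun y z ↦ by
        funext v
        exact Subtype.ext (by simp) }
  -- `ker Φ ≤ S₀`
  have hker : Φ.ker ≤ S0.addSubgroupOf A := by
    intro y hy
    rw [AddMonoidHom.mem_ker] at hy
    rw [AddSubgroup.mem_addSubgroupOf, hS0,
      mem_strictSignedSelmerLayer_zero_iff_of_layerToInfty_mem W κ ℚ_[p] 1 S hS (hsel y)]
    have hlocy := hloc (y : W.subgroupH1 p (κ.layerSubgroup 0)) y.2
    refine ⟨fun v hv ↦ ?_, hlocy⟩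
    by_cases hpv : (p : 𝓞 ℚ) ∈ v.asIdeal
    · -- `v = (p)`: the plus Kummer condition at `ℚ_[p]` refines the classical one, transported to `ℚ_v`
      have hvv : v = v₀ := (natCast_mem_asIdeal_iff_eq_primesEquiv_symm v hp.out).mp hpv
      rw [hvv]
      have h1 : (y : W.subgroupH1 p (κ.layerSubgroup 0)) ∈
          W.localKerOver p (κ.layerSubgroup 0) ℚ_[p] := by
        rw [localKerOver_eq_ofEmb]
        exact Kobayashi2003.localKummerOverOfEmb_le_localKerOverOfEmb _ hlocy
      exact (W.mem_localKerOver_iff p (κ.layerSubgroup 0) _ _).mp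
        ((StrictSignedControlZero.mem_localKerOver_padic_iff_adicCompletion W p (κ.layerSubgroup 0) κ.layerSubgroup_zero _).mp h1)
    · -- `v ∈ S`, `v ∤ p`: the `v`-component of `Φ y = 0`
      have hvS' : v ∈ S' := Finset.mem_filter.mpr ⟨hv, hpv⟩
      have h := congrFun hy ⟨v, hvS'⟩
      exact congrArg Subtype.val h
  -- counting: `#(A⧸S₀) ∣ #(A⧸ker Φ) = #range Φ ∣ #∏`
  have h1 : Nat.card (A ⧸ S0.addSubgroupOf A) ∣ Nat.card (A ⧸ Φ.ker) :=
    AddSubgroup.index_dvd_of_le hker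
  have h2 : Nat.card (A ⧸ Φ.ker) = Nat.card Φ.range := AddSubgroup.index_ker Φ
  have h3 : Nat.card Φ.range ∣
      Nat.card ((v : S') → W.localTowerKerPrimary κ ((v : HeightOneSpectrum (𝓞 ℚ)).adicCompletion ℚ) 0) :=
    AddSubgroup.card_addSubgroup_dvd_card Φ.range
  rw [Nat.card_pi] at h3
  rw [← Finset.prod_coe_sort S']
  exact h1.trans (h2 ▸ h3)

omit [W.IsGloballyMinimal] in
/-- `Sel⁺(W/ℚ_0) ≤ A₀⁺ = Sel^{loc,∞,+}(W/ℚ)` for the `p*`-twist (x1b's B2, `W(ℚ_{p,∞})[p^∞] = 0`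
discharged for the twist): the bottom layer restricts into the level-`∞` plus structure.
[cite: Kobayashi2003, Lemma 9.1 (p. 25), Prop. 8.7 (p. 16)] -/
theorem layer_le_localPreimage (hp2 : p ≠ 2) (C : VariableChange ℚ)
    (V : WeierstrassCurve ℚ) [V.IsElliptic] [V.IsGloballyMinimal]
    (hCV : C • W.quadraticTwist ((-1) ^ (p / 2) * p) = V)
    (hgood : V.HasGoodReductionAtPrime p) (hap : V.frobeniusTrace p = 0) :
    strictSignedSelmerLayer W κ ℚ_[p] 1 0 ≤ (W.selmerInfty κ ⊓
          ⨅ σ : Field.absoluteGaloisGroup ℚ,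
            (Kobayashi2003.localKummerOverOfEmb W p κ.kerSubgroup (closureEmb (K := ℚ) ℚ_[p])
                (⨆ m, strictSignedLocalPoints κ ℚ_[p] W 1 m)).comap (W.conjH1 p κ.kerSubgroup σ)).comap
          (W.layerToInfty κ 0) := by
  obtain ⟨M, hΔ, hA, hVM⟩ := exists_goodSupersingularPadicModel hp2 V hgood hap
  obtain ⟨S, hS⟩ := exists_finset_forall_not_mem_good W p
  have hc := sq_ne_neg_one_pow_mul_prime hp.out (p / 2)
  have htors := eq_zero_of_prime_pow_smul_eq_zero_localFixedPointsOfEmb_kerSubgroup_of_quadraticTwist κ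
    (closureEmb (K := ℚ) ℚ_[p]) hp2 W hc C hCV M hΔ hA hVM
  rw [← comap_layerToInfty_zero_strictSignedSelmerInfty_eq W κ ℚ_[p] 1 S hS htors,
    ← AddSubgroup.map_le_iff_le_comap]
  exact map_layerToInfty_strictSignedSelmerLayer_le W κ ℚ_[p] 1 0

/-- **`Sel_{p^∞}(W/ℚ)` finite ⟹ `A₀⁺ = Sel^{loc,∞,+}(W/ℚ)` finite** for the `p*`-twist, `κ`
cyclotomic: `#Sel⁺(W/ℚ_0) = #Sel_{p^∞}(W/ℚ)` (ctrl g2 file 1) is finite and the index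
`[A₀⁺ : Sel⁺(W/ℚ_0)]` divides `∏ p^{ord_p c_v} ≠ 0` (§2). No dual datum, no Poitou–Tate, no Kato.
[cite: GreenbergLNM1716, §3 Lemma 3.3 and p. 90] [cite: Kobayashi2003, Thm. 9.3 with (9.33) (pp. 26–27)] -/
theorem finite_localPreimage_of_finite_selmer (hp2 : p ≠ 2) (hκ : κ.IsCyclotomic) (C : VariableChange ℚ)
    (V : WeierstrassCurve ℚ) [V.IsElliptic] [V.IsGloballyMinimal]
    (hCV : C • W.quadraticTwist ((-1) ^ (p / 2) * p) = V)
    (hgood : V.HasGoodReductionAtPrime p) (hap : V.frobeniusTrace p = 0)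
    [hfinSel : Finite ↥(W.selmerGroupPInfty p)] :
    Finite (↥((W.selmerInfty κ ⊓
          ⨅ σ : Field.absoluteGaloisGroup ℚ,
            (Kobayashi2003.localKummerOverOfEmb W p κ.kerSubgroup (closureEmb (K := ℚ) ℚ_[p])
                (⨆ m, strictSignedLocalPoints κ ℚ_[p] W 1 m)).comap (W.conjH1 p κ.kerSubgroup σ)).comap
          (W.layerToInfty κ 0))) := by
  obtain ⟨S, hS⟩ := exists_finset_forall_not_mem_good W p
  set A := (W.selmerInfty κ ⊓
      ⨅ σ : Field.absoluteGaloisGroup ℚ,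
        (Kobayashi2003.localKummerOverOfEmb W p κ.kerSubgroup (closureEmb (K := ℚ) ℚ_[p])
            (⨆ m, strictSignedLocalPoints κ ℚ_[p] W 1 m)).comap (W.conjH1 p κ.kerSubgroup σ)).comap
      (W.layerToInfty κ 0) with hAdef
  set S0 := strictSignedSelmerLayer W κ ℚ_[p] 1 0 with hS0
  have hdvd := natCard_quotient_dvd_prod_pow κ W hp2 hκ C V hCV hgood hap S hS
  have hne : ∏ v ∈ S.filter (fun v ↦ (p : 𝓞 ℚ) ∉ v.asIdeal),
      p ^ padicValNat p ((W.baseChange (v.adicCompletion ℚ)).localTamagawaNumber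
        (v.adicCompletionIntegers ℚ)) ≠ 0 :=
    Finset.prod_ne_zero_iff.mpr fun _ _ ↦ pow_ne_zero _ hp.out.ne_zero
  haveI hfinQ : Finite (A ⧸ S0.addSubgroupOf A) :=
    Nat.finite_of_card_ne_zero fun h0 ↦ hne (Nat.eq_zero_of_zero_dvd (h0 ▸ hdvd))
  have hle : S0 ≤ A := layer_le_localPreimage κ W hp2 C V hCV hgood hap
  have hcardS := StrictSignedLayerZero.natCard_strictSignedSelmerLayer_one_zero_eq_selmerGroupPInfty W κ
  haveI : Finite S0 := Nat.finite_of_card_ne_zero (by rw [hS0, hcardS]; exact Nat.card_pos.ne')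
  haveI : Finite (S0.addSubgroupOf A) :=
    Finite.of_equiv _ (AddSubgroup.addSubgroupOfEquivOfLe hle).toEquiv.symm
  exact (AddSubgroup.finite_iff_finite_and_finiteIndex (S0.addSubgroupOf A)).mpr
    ⟨inferInstance, AddSubgroup.finiteIndex_of_finite_quotient⟩

/-- **Kobayashi's Thm. 2.2 at `η`, TORSION HALF, on the analytic-rank-`0` rows — a THEOREM.** For the
`p*`-twist `W` of a globally minimal good `a_p = 0` curve `V` (`p` odd, `κ` cyclotomic, `γ` a
topological generator) with `Sel_{p^∞}(W/ℚ)` FINITE: every Pontryagin-dual datum `D` of `Sel⁺(W/ℚ_∞)`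
— equivalently (ctrl g4's (D5⁺)⁻¹) of `Sel⁺(V/K_∞)^η` — has `X` finitely generated `Λ`-TORSION, and
every characteristic generator `g` has `ord_T g = 0`, `g(0) ≠ 0`. §2 + x1b's file 110
(`moduleFinite_isTorsion_constantCoeff_ne_zero_of_finite_localPreimage_of_quadraticTwist_signedPrime`).
UNCONDITIONAL (no named fact); Kitajima–Otsuki is not needed for this half.
[cite: Kobayashi2003, Thm. 2.2 (p. 5)] [cite: GreenbergLNM1716, §1 Thm. 1.4 (p. 60), §4 Lemma 4.2 (p. 102)] -/
theorem isTorsion_and_constantCoeff_ne_zero_of_finite_selmer (hp2 : p ≠ 2) (hκ : κ.IsCyclotomic)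
    (C : VariableChange ℚ) (V : WeierstrassCurve ℚ) [V.IsElliptic] [V.IsGloballyMinimal]
    (hCV : C • W.quadraticTwist ((-1) ^ (p / 2) * p) = V)
    (hgood : V.HasGoodReductionAtPrime p) (hap : V.frobeniusTrace p = 0)
    {γ : Field.absoluteGaloisGroup ℚ} (hγ : κ.IsTopGenerator γ)
    [Finite ↥(W.selmerGroupPInfty p)] (D : StrictSignedSelmerDualData W κ ℚ_[p] γ 1) :
    Module.Finite (IwasawaAlgebra p) D.X ∧ Module.IsTorsion (IwasawaAlgebra p) D.X ∧
      ∀ g : IwasawaAlgebra p, D.charIdeal = Ideal.span {g} →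
        g.order = 0 ∧ PowerSeries.constantCoeff g ≠ 0 :=
  StrictSignedControlZero.moduleFinite_isTorsion_constantCoeff_ne_zero_of_finite_localPreimage_of_quadraticTwist_signedPrime
    κ W 1 hp2 C V hCV hgood hap hγ D (finite_localPreimage_of_finite_selmer κ W hp2 hκ C V hCV hgood hap)

end Twist

end EtaBottomLayer

end Summit.BirchSwinnertonDyer.BirchSwinnertonDyer.Theorems

end
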